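import Mathlib

/-!
# Resonance table for Floquet multipliers of a breathing host: which δ = 0 eigenvalues can lock

HONEST FRAMING (cell `ns-blowup`, seat `ns-blowup-instab`, human ruling D-0035): nothing here is a
claim about Navier–Stokes blow-up. WHAT THIS IS NOT: not NS evidence; elementary complex
arithmetic behind the EXACT clauses (E-a2), (E-b) of instab's NOTE/CORRECTION on the identity rider
of P-X1″-B (STATUS 2026-08-25, before the arbiter's part 2b).

Dictionary. `K = P⁻¹Φ(T/3, 0)` is a REAL operator (`SpatioTemporalMonodromyFactorisation`), the
phase-0 monodromy is `M₀ = K³`. At `δ = 0` an eigenvalue `λ = γ + iω′` of the linearised operator in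
symmetry class `c` contributes `K`-multipliers `e^{λT/3}·χ` with `χ` an eigenvalue of `P⁻¹` on the
class (`1` for classes I/II, `ω^{±1}` for III), hence `M₀`-multipliers `e^{λT}` (the `χ`'s cube away).

* (E-a2) `conj_pow_three_eq_of_im_eq_zero` — `K` real ⇒ non-real `κ` come in conjugate pairs; if
  `κ³` is real then `(κ̄)³ = κ³`: a conjugate pair cubes to ONE real number (a DOUBLE real
  multiplier of `M₀`), never to two distinct ones. So a class-III REAL eigenvalue (conjugate
  `κ`-pair on the `±2π/3` directions) yields a double R+ at `δ = 0` which generically opens into a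
  near-real COMPLEX pair for `δ > 0` — it does not supply SIMPLE positive-real modes; only real
  eigenvalues of classes I/II (real simple `κ`) do (E-a1, persistence of a simple real eigenvalue).
* (E-b) `exp_mul_I_im_eq_zero_iff` / `exp_int_mul_pi_mul_I_re` — the `M₀`-multiplier `e^{iω′T}`
  direction of a complex pair `γ ± iω′` is real iff `ω′T = nπ` for an integer `n`, and then its sign
  is `(−1)^n`; with `T = 2π/Ω` (`resonance_iff`): `Ω = 2ω′/n` — R+ resonances for even `n`, R− for
  odd `n`. (Class I, `ω′ = 0.6266`: R+ at `Ω = 0.627, 0.313`, R− at `1.253, 0.418, 0.251`; class-III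
  Hopf, `ω′ = 0.6018`: R+ at `0.602, 0.301`, R− at `1.204, 0.401, 0.241`; `Ω = 0.5` is maximally
  detuned, `n = 2ω′/Ω ≈ 2.5 / 2.4`.)

Mathlib only; no new definitions.
-/

namespace Summit.NavierStokesRegularity.FluidComputer.FloquetResonanceTable

open Complex

/-- Conjugation commutes with cubing. -/
theorem conj_pow_three (κ : ℂ) : (starRingEnd ℂ κ) ^ 3 = starRingEnd ℂ (κ ^ 3) := by
  rw [map_pow]

/-- **(E-a2) A conjugate pair cubes to ONE real number.** If `κ³` is real then `(κ̄)³ = κ³`; so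
the two `M₀ = K³`-multipliers coming from a conjugate pair `κ, κ̄` of the real operator `K` are
EQUAL whenever they are real — a conjugate pair never yields two distinct real multipliers, in
particular never a SIMPLE one. -/
theorem conj_pow_three_eq_of_im_eq_zero {κ : ℂ} (h : (κ ^ 3).im = 0) :
    (starRingEnd ℂ κ) ^ 3 = κ ^ 3 := by
  rw [conj_pow_three]
  exact Complex.conj_eq_iff_im.mpr h

/-- Contrapositive bookkeeping: if the cubes of `κ` and `κ̄` are DIFFERENT, neither is real. -/
theorem im_pow_three_ne_zero_of_conj_pow_ne {κ : ℂ} (h : (starRingEnd ℂ κ) ^ 3 ≠ κ ^ 3) :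
    (κ ^ 3).im ≠ 0 := fun h0 => h (conj_pow_three_eq_of_im_eq_zero h0)

/-- **(E-b) The direction `e^{iθ}` is real iff `θ ∈ πℤ`.** -/
theorem exp_mul_I_im_eq_zero_iff (θ : ℝ) :
    (Complex.exp (θ * I)).im = 0 ↔ ∃ n : ℤ, (n : ℝ) * Real.pi = θ := by
  rw [Complex.exp_ofReal_mul_I_im, Real.sin_eq_zero_iff]

/-- **(E-b) … and then its sign is `(−1)^n`**: `Re e^{i n π} = (−1)^n` (R+ for even `n`, R− for
odd `n`). -/
theorem exp_int_mul_pi_mul_I_re (n : ℤ) :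
    (Complex.exp (((n : ℝ) * Real.pi : ℝ) * I)).re = (-1 : ℝ) ^ n := by
  rw [Complex.exp_ofReal_mul_I_re, Real.cos_int_mul_pi]

/-- Even resonance index ⇒ positive direction (R+). -/
theorem exp_int_mul_pi_mul_I_re_of_even {n : ℤ} (hn : Even n) :
    (Complex.exp (((n : ℝ) * Real.pi : ℝ) * I)).re = 1 := by
  rw [exp_int_mul_pi_mul_I_re, hn.neg_one_zpow]

/-- Odd resonance index ⇒ negative direction (R−). -/
theorem exp_int_mul_pi_mul_I_re_of_odd {n : ℤ} (hn : Odd n) :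
    (Complex.exp (((n : ℝ) * Real.pi : ℝ) * I)).re = -1 := by
  rw [exp_int_mul_pi_mul_I_re, hn.neg_one_zpow]

/-- **Resonance condition in terms of the forcing frequency**: with period `T = 2π/Ω` (`Ω ≠ 0`),
`ω′T = nπ` iff `Ω·n = 2ω′`, i.e. `Ω = 2ω′/n` for `n ≠ 0`. -/
theorem resonance_iff {ω' Ω : ℝ} (hΩ : Ω ≠ 0) (n : ℤ) :
    ω' * (2 * Real.pi / Ω) = n * Real.pi ↔ Ω * n = 2 * ω' := by
  have hπ : Real.pi ≠ 0 := Real.pi_ne_zero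
  constructor
  · intro h
    have h' : ω' * (2 * Real.pi) = n * Real.pi * Ω := by
      rw [← h]; field_simp
    have : (2 * ω' - Ω * n) * Real.pi = 0 := by linear_combination h'
    rcases mul_eq_zero.mp this with h1 | h1
    · linarith
    · exact absurd h1 hπ
  · intro h
    rw [show (n : ℝ) * Real.pi = (Ω * n) * Real.pi / Ω by field_simp]
    rw [h]; ring

end Summit.NavierStokesRegularity.FluidComputer.FloquetResonanceTable
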